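import Summits.Ventures.PercRepro.Night2ShapeOneCouplingHF
import Summits.Ventures.PercRepro.Night2ShapeOneCouplingKF

/-!
# PercRepro — the seven-point shape (i): THE FINITE CHECK (all regimes) (night-2, gen 30)

**`shapeOne_finite_check`** (proofs/NIGHT-2-g30.md §2, §4): the six sources of a seven-point one-coloop shape-(i)
target, with the type counts of the outside points (`e1o` on `ℓ₁`, `e2o` on `ℓ₂`, `eb` visible on both sides, of
which `eb01` / `eb02` are free on side `1` / `2`; `nZ` points off `H`, each visible on at least one side), the visible
counts of each side, admissible requests (`r ≤ ρ(2 + s)` for `s ≥ 1`; `0` or the fat `7/24` for `s = 0`; `r_H` likewise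
for `m_H = 1 + nZ`) and at most one fat request among the seven closures: (A) with the floor `|E| + |Z| ≥ 4` the six
losses split over the good points sum to at most `11/18 − r_H`; (B) they always sum to at most `23/45` (so to less
than `1 − r_H ≤ cap2` when the target has no layer-0 preimage).  Regimes: `r_H = 7/24` (H-fat: `m_H = 2`, one point
off `H`, Night2ShapeOneCouplingHF); one fat `K`-face (Night2ShapeOneCouplingKF, up to the symmetries of the faces and
the sides); no fat face (`shapeOne_couplingNF`).
-/

namespace PercRepro.Shadow

section Check

variable {e1o e2o eb eb01 eb02 nZ mH : ℕ} {rH : ℚ}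
variable {fE₁ a₁ a₂ a₃ zf₁ z₁ z₂ z₃ s₁ s₂ s₃ g₁ g₂ g₃ : ℕ} {r₁ r₂ r₃ : ℚ}
variable {fE₂ b₁ b₂ b₃ zf₂ y₁ y₂ y₃ t₁ t₂ t₃ h₁ h₂ h₃ : ℕ} {u₁ u₂ u₃ : ℚ}

/-- A non-fat admissible request: `r ≤ ρ(2 + s)` and `r = 0` at a null face. -/
theorem nonfat_of_adm {s : ℕ} {r : ℚ} (_hnn : 0 ≤ r) (hadm : 1 ≤ s → r ≤ rhoReq (2 + s))
    (h0 : s = 0 → r = 0 ∨ r = 7 / 24) (hne : r ≠ 7 / 24) : r ≤ rhoReq (2 + s) ∧ (s = 0 → r = 0) := by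
  rcases Nat.eq_zero_or_pos s with hs | hs
  · rcases h0 hs with h | h
    · exact ⟨by rw [h]; exact rhoReq_nonneg _, fun _ => h⟩
    · exact absurd h hne
  · exact ⟨hadm hs, fun h => absurd h (by omega)⟩

/-- A fat request sits on a null face. -/
theorem null_of_fat {s : ℕ} {r : ℚ} (hadm : 1 ≤ s → r ≤ rhoReq (2 + s)) (hr : r = 7 / 24) : s = 0 := by
  by_contra hne
  have := hadm (by omega)
  have h2 := rhoReq_le_thin (m := 2 + s) (by omega)
  rw [hr] at this
  linarith

/-- `r_H ≠ 7/24` gives `r_H ≤ 7/30`, `≤ 7/36` when `m_H ≥ 4`, `0` when `m_H = 2`. -/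
theorem rH_facts (_hHnn : 0 ≤ rH) (hH2 : mH = 2 → rH = 0 ∨ rH = 7 / 24) (hH3 : 3 ≤ mH → rH ≤ rhoReq mH)
    (hmH : mH = 1 + nZ) (hnZ : 1 ≤ nZ) (hne : rH ≠ 7 / 24) :
    rH ≤ 7 / 30 ∧ (3 ≤ nZ → rH ≤ 7 / 36) ∧ (nZ ≤ 1 → rH = 0) := by
  refine ⟨?_, ?_, ?_⟩
  · rcases Nat.lt_or_ge mH 3 with h | h
    · rcases hH2 (by omega) with h0 | h0
      · rw [h0]; norm_num
      · exact absurd h0 hne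
    · exact (hH3 h).trans (rhoReq_le_thin h)
  · intro h3
    have := hH3 (by omega)
    have h4 := rhoReq_anti (m := 4) (m' := mH) (by omega)
    rw [rhoReq_four] at h4
    linarith
  · intro h1
    rcases hH2 (by omega) with h0 | h0
    · exact h0
    · exact absurd h0 hne

/-- `r_H = 7/24` forces `m_H = 2`, i.e. one point off `H`. -/
theorem nZ_eq_one_of_rH_fat (hH3 : 3 ≤ mH → rH ≤ rhoReq mH) (hmH : mH = 1 + nZ) (hnZ : 1 ≤ nZ)
    (hr : rH = 7 / 24) : nZ = 1 := by
  by_contra hne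
  have := hH3 (by omega)
  have h2 := rhoReq_le_thin (m := mH) (by omega)
  rw [hr] at this
  linarith

set_option maxHeartbeats 1600000 in
/-- **THE FINITE CHECK, the fat face being the face `1` of side `1`** (`r₁ = 7/24`). -/
theorem shapeOne_check_KF1
    (hfE₁ : fE₁ = e1o + eb01) (hab : eb = eb01 + (a₁ + a₂ + a₃)) (hfE₂ : fE₂ = e2o + eb02)
    (hbb : eb = eb02 + (b₁ + b₂ + b₃)) (hmH : mH = 1 + nZ) (hnZ : 1 ≤ nZ)
    (hζ : nZ ≤ zf₁ + (z₁ + z₂ + z₃) + (zf₂ + (y₁ + y₂ + y₃))) (HZ1 : zf₁ + (z₁ + z₂ + z₃) ≤ nZ)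
    (HZ2 : zf₂ + (y₁ + y₂ + y₃) ≤ nZ)
    (hs₁ : s₁ = fE₁ + zf₁ + (a₂ + z₂) + (a₃ + z₃)) (hs₂ : s₂ = fE₁ + zf₁ + (a₁ + z₁) + (a₃ + z₃))
    (hs₃ : s₃ = fE₁ + zf₁ + (a₁ + z₁) + (a₂ + z₂))
    (hg₁ : g₁ = 1 + fE₁ + a₁ + zf₁ + (z₁ + z₂ + z₃)) (hg₂ : g₂ = 1 + fE₁ + a₂ + zf₁ + (z₁ + z₂ + z₃))
    (hg₃ : g₃ = 1 + fE₁ + a₃ + zf₁ + (z₁ + z₂ + z₃))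
    (ht₁ : t₁ = fE₂ + zf₂ + (b₂ + y₂) + (b₃ + y₃)) (ht₂ : t₂ = fE₂ + zf₂ + (b₁ + y₁) + (b₃ + y₃))
    (ht₃ : t₃ = fE₂ + zf₂ + (b₁ + y₁) + (b₂ + y₂))
    (hh₁ : h₁ = 1 + fE₂ + b₁ + zf₂ + (y₁ + y₂ + y₃)) (hh₂ : h₂ = 1 + fE₂ + b₂ + zf₂ + (y₁ + y₂ + y₃))
    (hh₃ : h₃ = 1 + fE₂ + b₃ + zf₂ + (y₁ + y₂ + y₃))
    (hHnn : 0 ≤ rH) (hH2 : mH = 2 → rH = 0 ∨ rH = 7 / 24) (hH3 : 3 ≤ mH → rH ≤ rhoReq mH)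
    (hr₁nn : 0 ≤ r₁) (hr₁adm : 1 ≤ s₁ → r₁ ≤ rhoReq (2 + s₁)) (hr₁0 : s₁ = 0 → r₁ = 0 ∨ r₁ = 7 / 24)
    (hr₂nn : 0 ≤ r₂) (hr₂adm : 1 ≤ s₂ → r₂ ≤ rhoReq (2 + s₂)) (hr₂0 : s₂ = 0 → r₂ = 0 ∨ r₂ = 7 / 24)
    (hr₃nn : 0 ≤ r₃) (hr₃adm : 1 ≤ s₃ → r₃ ≤ rhoReq (2 + s₃)) (hr₃0 : s₃ = 0 → r₃ = 0 ∨ r₃ = 7 / 24)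
    (hu₁nn : 0 ≤ u₁) (hu₁adm : 1 ≤ t₁ → u₁ ≤ rhoReq (2 + t₁)) (hu₁0 : t₁ = 0 → u₁ = 0 ∨ u₁ = 7 / 24)
    (hu₂nn : 0 ≤ u₂) (hu₂adm : 1 ≤ t₂ → u₂ ≤ rhoReq (2 + t₂)) (hu₂0 : t₂ = 0 → u₂ = 0 ∨ u₂ = 7 / 24)
    (hu₃nn : 0 ≤ u₃) (hu₃adm : 1 ≤ t₃ → u₃ ≤ rhoReq (2 + t₃)) (hu₃0 : t₃ = 0 → u₃ = 0 ∨ u₃ = 7 / 24)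
    (hfat : (rH = 7 / 24 → r₁ ≠ 7 / 24 ∧ r₂ ≠ 7 / 24 ∧ r₃ ≠ 7 / 24 ∧ u₁ ≠ 7 / 24 ∧ u₂ ≠ 7 / 24 ∧ u₃ ≠ 7 / 24) ∧
      (r₁ = 7 / 24 → r₂ ≠ 7 / 24 ∧ r₃ ≠ 7 / 24 ∧ u₁ ≠ 7 / 24 ∧ u₂ ≠ 7 / 24 ∧ u₃ ≠ 7 / 24) ∧
      (r₂ = 7 / 24 → r₃ ≠ 7 / 24 ∧ u₁ ≠ 7 / 24 ∧ u₂ ≠ 7 / 24 ∧ u₃ ≠ 7 / 24) ∧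
      (r₃ = 7 / 24 → u₁ ≠ 7 / 24 ∧ u₂ ≠ 7 / 24 ∧ u₃ ≠ 7 / 24) ∧
      (u₁ = 7 / 24 → u₂ ≠ 7 / 24 ∧ u₃ ≠ 7 / 24) ∧
      (u₂ = 7 / 24 → u₃ ≠ 7 / 24))
    (h1fat : r₁ = 7 / 24) :
    (4 ≤ e1o + e2o + eb + nZ → (max (rH + r₂ + r₃ - 11 / 18) 0 / (g₁ : ℚ) + max (rH + r₁ + r₃ - 11 / 18) 0 / (g₂ : ℚ) +
      max (rH + r₁ + r₂ - 11 / 18) 0 / (g₃ : ℚ)) +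
    (max (rH + u₂ + u₃ - 11 / 18) 0 / (h₁ : ℚ) + max (rH + u₁ + u₃ - 11 / 18) 0 / (h₂ : ℚ) +
      max (rH + u₁ + u₂ - 11 / 18) 0 / (h₃ : ℚ)) ≤ 11 / 18 - rH) ∧
    (max (rH + r₂ + r₃ - 11 / 18) 0 / (g₁ : ℚ) + max (rH + r₁ + r₃ - 11 / 18) 0 / (g₂ : ℚ) +
      max (rH + r₁ + r₂ - 11 / 18) 0 / (g₃ : ℚ)) +
    (max (rH + u₂ + u₃ - 11 / 18) 0 / (h₁ : ℚ) + max (rH + u₁ + u₃ - 11 / 18) 0 / (h₂ : ℚ) +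
      max (rH + u₁ + u₂ - 11 / 18) 0 / (h₃ : ℚ)) ≤ 23 / 45 := by
  obtain ⟨hn2, hn3, hnu1, hnu2, hnu3⟩ := hfat.2.1 h1fat
  have _ := HZ1
  have _ := HZ2
  have hHne : rH ≠ 7 / 24 := fun h => (hfat.1 h).1 h1fat
  obtain ⟨hH, hH36, hH0⟩ := rH_facts hHnn hH2 hH3 hmH hnZ hHne
  have hs₁0 : s₁ = 0 := null_of_fat hr₁adm h1fat
  obtain ⟨hr₂, h₂0⟩ := nonfat_of_adm hr₂nn hr₂adm hr₂0 hn2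
  obtain ⟨hr₃, h₃0⟩ := nonfat_of_adm hr₃nn hr₃adm hr₃0 hn3
  obtain ⟨hu₁, hu₁0⟩ := nonfat_of_adm hu₁nn hu₁adm hu₁0 hnu1
  obtain ⟨hu₂, hu₂0⟩ := nonfat_of_adm hu₂nn hu₂adm hu₂0 hnu2
  obtain ⟨hu₃, hu₃0⟩ := nonfat_of_adm hu₃nn hu₃adm hu₃0 hnu3
  subst h1fat
  constructor
  · intro hOut
    exact shapeOne_couplingKF hH hH36 hH0 hOut hfE₁ hab hfE₂ hbb hζ hs₁ hs₂ hs₃ hg₁ hg₂ hg₃ hs₁0 hr₂ h₂0 hr₃ h₃0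
      ht₁ ht₂ ht₃ hh₁ hh₂ hh₃ hu₁ hu₁0 hu₂ hu₂0 hu₃ hu₃0
  · obtain ⟨K1, -, -, -⟩ := sideKF_le hs₁ hs₂ hs₃ hg₁ hg₂ hg₃ hs₁0 hr₂ h₂0 hr₃ h₃0 hH
    obtain ⟨hM₁, hC₁, hm₁⟩ := lossNF_props hH hu₂ hu₂0 hu₃ hu₃0
    obtain ⟨hM₂, hC₂, hm₂⟩ := lossNF_props hH hu₁ hu₁0 hu₃ hu₃0
    obtain ⟨hM₃, hC₃, hm₃⟩ := lossNF_props hH hu₁ hu₁0 hu₂ hu₂0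
    have S2 := sideNF_core_P1 ht₁ ht₂ ht₃ hh₁ hh₂ hh₃ hM₁ hC₁ hm₁ hM₂ hC₂ hm₂ hM₃ hC₃ hm₃
    linarith

/-- The fat rule is invariant under swapping the faces `1`, `2` of side `1`. -/
theorem fatRule_perm12 {rH r₁ r₂ r₃ u₁ u₂ u₃ : ℚ} (hfat : (rH = 7 / 24 → r₁ ≠ 7 / 24 ∧ r₂ ≠ 7 / 24 ∧ r₃ ≠ 7 / 24 ∧ u₁ ≠ 7 / 24 ∧ u₂ ≠ 7 / 24 ∧ u₃ ≠ 7 / 24) ∧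
      (r₁ = 7 / 24 → r₂ ≠ 7 / 24 ∧ r₃ ≠ 7 / 24 ∧ u₁ ≠ 7 / 24 ∧ u₂ ≠ 7 / 24 ∧ u₃ ≠ 7 / 24) ∧
      (r₂ = 7 / 24 → r₃ ≠ 7 / 24 ∧ u₁ ≠ 7 / 24 ∧ u₂ ≠ 7 / 24 ∧ u₃ ≠ 7 / 24) ∧
      (r₃ = 7 / 24 → u₁ ≠ 7 / 24 ∧ u₂ ≠ 7 / 24 ∧ u₃ ≠ 7 / 24) ∧
      (u₁ = 7 / 24 → u₂ ≠ 7 / 24 ∧ u₃ ≠ 7 / 24) ∧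
      (u₂ = 7 / 24 → u₃ ≠ 7 / 24)) :
    (rH = 7 / 24 → r₂ ≠ 7 / 24 ∧ r₁ ≠ 7 / 24 ∧ r₃ ≠ 7 / 24 ∧ u₁ ≠ 7 / 24 ∧ u₂ ≠ 7 / 24 ∧ u₃ ≠ 7 / 24) ∧
      (r₂ = 7 / 24 → r₁ ≠ 7 / 24 ∧ r₃ ≠ 7 / 24 ∧ u₁ ≠ 7 / 24 ∧ u₂ ≠ 7 / 24 ∧ u₃ ≠ 7 / 24) ∧
      (r₁ = 7 / 24 → r₃ ≠ 7 / 24 ∧ u₁ ≠ 7 / 24 ∧ u₂ ≠ 7 / 24 ∧ u₃ ≠ 7 / 24) ∧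
      (r₃ = 7 / 24 → u₁ ≠ 7 / 24 ∧ u₂ ≠ 7 / 24 ∧ u₃ ≠ 7 / 24) ∧
      (u₁ = 7 / 24 → u₂ ≠ 7 / 24 ∧ u₃ ≠ 7 / 24) ∧
      (u₂ = 7 / 24 → u₃ ≠ 7 / 24) := by
  tauto

/-- The fat rule is invariant under swapping the faces `1`, `3` of side `1`. -/
theorem fatRule_perm13 {rH r₁ r₂ r₃ u₁ u₂ u₃ : ℚ} (hfat : (rH = 7 / 24 → r₁ ≠ 7 / 24 ∧ r₂ ≠ 7 / 24 ∧ r₃ ≠ 7 / 24 ∧ u₁ ≠ 7 / 24 ∧ u₂ ≠ 7 / 24 ∧ u₃ ≠ 7 / 24) ∧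
      (r₁ = 7 / 24 → r₂ ≠ 7 / 24 ∧ r₃ ≠ 7 / 24 ∧ u₁ ≠ 7 / 24 ∧ u₂ ≠ 7 / 24 ∧ u₃ ≠ 7 / 24) ∧
      (r₂ = 7 / 24 → r₃ ≠ 7 / 24 ∧ u₁ ≠ 7 / 24 ∧ u₂ ≠ 7 / 24 ∧ u₃ ≠ 7 / 24) ∧
      (r₃ = 7 / 24 → u₁ ≠ 7 / 24 ∧ u₂ ≠ 7 / 24 ∧ u₃ ≠ 7 / 24) ∧
      (u₁ = 7 / 24 → u₂ ≠ 7 / 24 ∧ u₃ ≠ 7 / 24) ∧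
      (u₂ = 7 / 24 → u₃ ≠ 7 / 24)) :
    (rH = 7 / 24 → r₃ ≠ 7 / 24 ∧ r₂ ≠ 7 / 24 ∧ r₁ ≠ 7 / 24 ∧ u₁ ≠ 7 / 24 ∧ u₂ ≠ 7 / 24 ∧ u₃ ≠ 7 / 24) ∧
      (r₃ = 7 / 24 → r₂ ≠ 7 / 24 ∧ r₁ ≠ 7 / 24 ∧ u₁ ≠ 7 / 24 ∧ u₂ ≠ 7 / 24 ∧ u₃ ≠ 7 / 24) ∧
      (r₂ = 7 / 24 → r₁ ≠ 7 / 24 ∧ u₁ ≠ 7 / 24 ∧ u₂ ≠ 7 / 24 ∧ u₃ ≠ 7 / 24) ∧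
      (r₁ = 7 / 24 → u₁ ≠ 7 / 24 ∧ u₂ ≠ 7 / 24 ∧ u₃ ≠ 7 / 24) ∧
      (u₁ = 7 / 24 → u₂ ≠ 7 / 24 ∧ u₃ ≠ 7 / 24) ∧
      (u₂ = 7 / 24 → u₃ ≠ 7 / 24) := by
  tauto

/-- The fat rule is invariant under swapping the two sides. -/
theorem fatRule_swap {rH r₁ r₂ r₃ u₁ u₂ u₃ : ℚ} (hfat : (rH = 7 / 24 → r₁ ≠ 7 / 24 ∧ r₂ ≠ 7 / 24 ∧ r₃ ≠ 7 / 24 ∧ u₁ ≠ 7 / 24 ∧ u₂ ≠ 7 / 24 ∧ u₃ ≠ 7 / 24) ∧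
      (r₁ = 7 / 24 → r₂ ≠ 7 / 24 ∧ r₃ ≠ 7 / 24 ∧ u₁ ≠ 7 / 24 ∧ u₂ ≠ 7 / 24 ∧ u₃ ≠ 7 / 24) ∧
      (r₂ = 7 / 24 → r₃ ≠ 7 / 24 ∧ u₁ ≠ 7 / 24 ∧ u₂ ≠ 7 / 24 ∧ u₃ ≠ 7 / 24) ∧
      (r₃ = 7 / 24 → u₁ ≠ 7 / 24 ∧ u₂ ≠ 7 / 24 ∧ u₃ ≠ 7 / 24) ∧
      (u₁ = 7 / 24 → u₂ ≠ 7 / 24 ∧ u₃ ≠ 7 / 24) ∧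
      (u₂ = 7 / 24 → u₃ ≠ 7 / 24)) :
    (rH = 7 / 24 → u₁ ≠ 7 / 24 ∧ u₂ ≠ 7 / 24 ∧ u₃ ≠ 7 / 24 ∧ r₁ ≠ 7 / 24 ∧ r₂ ≠ 7 / 24 ∧ r₃ ≠ 7 / 24) ∧
      (u₁ = 7 / 24 → u₂ ≠ 7 / 24 ∧ u₃ ≠ 7 / 24 ∧ r₁ ≠ 7 / 24 ∧ r₂ ≠ 7 / 24 ∧ r₃ ≠ 7 / 24) ∧
      (u₂ = 7 / 24 → u₃ ≠ 7 / 24 ∧ r₁ ≠ 7 / 24 ∧ r₂ ≠ 7 / 24 ∧ r₃ ≠ 7 / 24) ∧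
      (u₃ = 7 / 24 → r₁ ≠ 7 / 24 ∧ r₂ ≠ 7 / 24 ∧ r₃ ≠ 7 / 24) ∧
      (r₁ = 7 / 24 → r₂ ≠ 7 / 24 ∧ r₃ ≠ 7 / 24) ∧
      (r₂ = 7 / 24 → r₃ ≠ 7 / 24) := by
  tauto

set_option maxHeartbeats 800000 in
/-- The finite check when the fat face is the face `2` of side `1`. -/
theorem shapeOne_check_KF2
    (hfE₁ : fE₁ = e1o + eb01) (hab : eb = eb01 + (a₁ + a₂ + a₃)) (hfE₂ : fE₂ = e2o + eb02)
    (hbb : eb = eb02 + (b₁ + b₂ + b₃)) (hmH : mH = 1 + nZ) (hnZ : 1 ≤ nZ)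
    (hζ : nZ ≤ zf₁ + (z₁ + z₂ + z₃) + (zf₂ + (y₁ + y₂ + y₃))) (HZ1 : zf₁ + (z₁ + z₂ + z₃) ≤ nZ)
    (HZ2 : zf₂ + (y₁ + y₂ + y₃) ≤ nZ)
    (hs₁ : s₁ = fE₁ + zf₁ + (a₂ + z₂) + (a₃ + z₃)) (hs₂ : s₂ = fE₁ + zf₁ + (a₁ + z₁) + (a₃ + z₃))
    (hs₃ : s₃ = fE₁ + zf₁ + (a₁ + z₁) + (a₂ + z₂))
    (hg₁ : g₁ = 1 + fE₁ + a₁ + zf₁ + (z₁ + z₂ + z₃)) (hg₂ : g₂ = 1 + fE₁ + a₂ + zf₁ + (z₁ + z₂ + z₃))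
    (hg₃ : g₃ = 1 + fE₁ + a₃ + zf₁ + (z₁ + z₂ + z₃))
    (ht₁ : t₁ = fE₂ + zf₂ + (b₂ + y₂) + (b₃ + y₃)) (ht₂ : t₂ = fE₂ + zf₂ + (b₁ + y₁) + (b₃ + y₃))
    (ht₃ : t₃ = fE₂ + zf₂ + (b₁ + y₁) + (b₂ + y₂))
    (hh₁ : h₁ = 1 + fE₂ + b₁ + zf₂ + (y₁ + y₂ + y₃)) (hh₂ : h₂ = 1 + fE₂ + b₂ + zf₂ + (y₁ + y₂ + y₃))
    (hh₃ : h₃ = 1 + fE₂ + b₃ + zf₂ + (y₁ + y₂ + y₃))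
    (hHnn : 0 ≤ rH) (hH2 : mH = 2 → rH = 0 ∨ rH = 7 / 24) (hH3 : 3 ≤ mH → rH ≤ rhoReq mH)
    (hr₁nn : 0 ≤ r₁) (hr₁adm : 1 ≤ s₁ → r₁ ≤ rhoReq (2 + s₁)) (hr₁0 : s₁ = 0 → r₁ = 0 ∨ r₁ = 7 / 24)
    (hr₂nn : 0 ≤ r₂) (hr₂adm : 1 ≤ s₂ → r₂ ≤ rhoReq (2 + s₂)) (hr₂0 : s₂ = 0 → r₂ = 0 ∨ r₂ = 7 / 24)
    (hr₃nn : 0 ≤ r₃) (hr₃adm : 1 ≤ s₃ → r₃ ≤ rhoReq (2 + s₃)) (hr₃0 : s₃ = 0 → r₃ = 0 ∨ r₃ = 7 / 24)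
    (hu₁nn : 0 ≤ u₁) (hu₁adm : 1 ≤ t₁ → u₁ ≤ rhoReq (2 + t₁)) (hu₁0 : t₁ = 0 → u₁ = 0 ∨ u₁ = 7 / 24)
    (hu₂nn : 0 ≤ u₂) (hu₂adm : 1 ≤ t₂ → u₂ ≤ rhoReq (2 + t₂)) (hu₂0 : t₂ = 0 → u₂ = 0 ∨ u₂ = 7 / 24)
    (hu₃nn : 0 ≤ u₃) (hu₃adm : 1 ≤ t₃ → u₃ ≤ rhoReq (2 + t₃)) (hu₃0 : t₃ = 0 → u₃ = 0 ∨ u₃ = 7 / 24)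
    (hfat : (rH = 7 / 24 → r₁ ≠ 7 / 24 ∧ r₂ ≠ 7 / 24 ∧ r₃ ≠ 7 / 24 ∧ u₁ ≠ 7 / 24 ∧ u₂ ≠ 7 / 24 ∧ u₃ ≠ 7 / 24) ∧
      (r₁ = 7 / 24 → r₂ ≠ 7 / 24 ∧ r₃ ≠ 7 / 24 ∧ u₁ ≠ 7 / 24 ∧ u₂ ≠ 7 / 24 ∧ u₃ ≠ 7 / 24) ∧
      (r₂ = 7 / 24 → r₃ ≠ 7 / 24 ∧ u₁ ≠ 7 / 24 ∧ u₂ ≠ 7 / 24 ∧ u₃ ≠ 7 / 24) ∧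
      (r₃ = 7 / 24 → u₁ ≠ 7 / 24 ∧ u₂ ≠ 7 / 24 ∧ u₃ ≠ 7 / 24) ∧
      (u₁ = 7 / 24 → u₂ ≠ 7 / 24 ∧ u₃ ≠ 7 / 24) ∧
      (u₂ = 7 / 24 → u₃ ≠ 7 / 24))
    (h2fat : r₂ = 7 / 24) :
    (4 ≤ e1o + e2o + eb + nZ → (max (rH + r₂ + r₃ - 11 / 18) 0 / (g₁ : ℚ) + max (rH + r₁ + r₃ - 11 / 18) 0 / (g₂ : ℚ) +
      max (rH + r₁ + r₂ - 11 / 18) 0 / (g₃ : ℚ)) +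
    (max (rH + u₂ + u₃ - 11 / 18) 0 / (h₁ : ℚ) + max (rH + u₁ + u₃ - 11 / 18) 0 / (h₂ : ℚ) +
      max (rH + u₁ + u₂ - 11 / 18) 0 / (h₃ : ℚ)) ≤ 11 / 18 - rH) ∧
    (max (rH + r₂ + r₃ - 11 / 18) 0 / (g₁ : ℚ) + max (rH + r₁ + r₃ - 11 / 18) 0 / (g₂ : ℚ) +
      max (rH + r₁ + r₂ - 11 / 18) 0 / (g₃ : ℚ)) +
    (max (rH + u₂ + u₃ - 11 / 18) 0 / (h₁ : ℚ) + max (rH + u₁ + u₃ - 11 / 18) 0 / (h₂ : ℚ) +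
      max (rH + u₁ + u₂ - 11 / 18) 0 / (h₃ : ℚ)) ≤ 23 / 45 := by
  have h := shapeOne_check_KF1 (e1o := e1o) (e2o := e2o) (eb := eb) (eb01 := eb01) (eb02 := eb02) (nZ := nZ) (mH := mH)
    (rH := rH) (fE₁ := fE₁) (a₁ := a₂) (a₂ := a₁) (a₃ := a₃) (zf₁ := zf₁) (z₁ := z₂) (z₂ := z₁) (z₃ := z₃)
    (s₁ := s₂) (s₂ := s₁) (s₃ := s₃) (g₁ := g₂) (g₂ := g₁) (g₃ := g₃) (r₁ := r₂) (r₂ := r₁) (r₃ := r₃)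
    hfE₁ (by omega) hfE₂ hbb hmH hnZ (by omega) (by omega) HZ2 (by omega) (by omega) (by omega) (by omega) (by omega) (by omega) ht₁ ht₂ ht₃ hh₁ hh₂ hh₃ hHnn hH2 hH3 hr₂nn hr₂adm hr₂0 hr₁nn hr₁adm hr₁0 hr₃nn hr₃adm hr₃0 hu₁nn hu₁adm hu₁0 hu₂nn hu₂adm hu₂0 hu₃nn hu₃adm hu₃0 (fatRule_perm12 hfat) h2fat
  have e : max (rH + r₂ + r₁ - 11 / 18) 0 = max (rH + r₁ + r₂ - 11 / 18) 0 := by rw [add_right_comm]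
  rw [e] at h
  exact ⟨fun hOut => by linarith [h.1 hOut], by linarith [h.2]⟩

set_option maxHeartbeats 800000 in
/-- The finite check when the fat face is the face `3` of side `1`. -/
theorem shapeOne_check_KF3
    (hfE₁ : fE₁ = e1o + eb01) (hab : eb = eb01 + (a₁ + a₂ + a₃)) (hfE₂ : fE₂ = e2o + eb02)
    (hbb : eb = eb02 + (b₁ + b₂ + b₃)) (hmH : mH = 1 + nZ) (hnZ : 1 ≤ nZ)
    (hζ : nZ ≤ zf₁ + (z₁ + z₂ + z₃) + (zf₂ + (y₁ + y₂ + y₃))) (HZ1 : zf₁ + (z₁ + z₂ + z₃) ≤ nZ)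
    (HZ2 : zf₂ + (y₁ + y₂ + y₃) ≤ nZ)
    (hs₁ : s₁ = fE₁ + zf₁ + (a₂ + z₂) + (a₃ + z₃)) (hs₂ : s₂ = fE₁ + zf₁ + (a₁ + z₁) + (a₃ + z₃))
    (hs₃ : s₃ = fE₁ + zf₁ + (a₁ + z₁) + (a₂ + z₂))
    (hg₁ : g₁ = 1 + fE₁ + a₁ + zf₁ + (z₁ + z₂ + z₃)) (hg₂ : g₂ = 1 + fE₁ + a₂ + zf₁ + (z₁ + z₂ + z₃))
    (hg₃ : g₃ = 1 + fE₁ + a₃ + zf₁ + (z₁ + z₂ + z₃))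
    (ht₁ : t₁ = fE₂ + zf₂ + (b₂ + y₂) + (b₃ + y₃)) (ht₂ : t₂ = fE₂ + zf₂ + (b₁ + y₁) + (b₃ + y₃))
    (ht₃ : t₃ = fE₂ + zf₂ + (b₁ + y₁) + (b₂ + y₂))
    (hh₁ : h₁ = 1 + fE₂ + b₁ + zf₂ + (y₁ + y₂ + y₃)) (hh₂ : h₂ = 1 + fE₂ + b₂ + zf₂ + (y₁ + y₂ + y₃))
    (hh₃ : h₃ = 1 + fE₂ + b₃ + zf₂ + (y₁ + y₂ + y₃))
    (hHnn : 0 ≤ rH) (hH2 : mH = 2 → rH = 0 ∨ rH = 7 / 24) (hH3 : 3 ≤ mH → rH ≤ rhoReq mH)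
    (hr₁nn : 0 ≤ r₁) (hr₁adm : 1 ≤ s₁ → r₁ ≤ rhoReq (2 + s₁)) (hr₁0 : s₁ = 0 → r₁ = 0 ∨ r₁ = 7 / 24)
    (hr₂nn : 0 ≤ r₂) (hr₂adm : 1 ≤ s₂ → r₂ ≤ rhoReq (2 + s₂)) (hr₂0 : s₂ = 0 → r₂ = 0 ∨ r₂ = 7 / 24)
    (hr₃nn : 0 ≤ r₃) (hr₃adm : 1 ≤ s₃ → r₃ ≤ rhoReq (2 + s₃)) (hr₃0 : s₃ = 0 → r₃ = 0 ∨ r₃ = 7 / 24)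
    (hu₁nn : 0 ≤ u₁) (hu₁adm : 1 ≤ t₁ → u₁ ≤ rhoReq (2 + t₁)) (hu₁0 : t₁ = 0 → u₁ = 0 ∨ u₁ = 7 / 24)
    (hu₂nn : 0 ≤ u₂) (hu₂adm : 1 ≤ t₂ → u₂ ≤ rhoReq (2 + t₂)) (hu₂0 : t₂ = 0 → u₂ = 0 ∨ u₂ = 7 / 24)
    (hu₃nn : 0 ≤ u₃) (hu₃adm : 1 ≤ t₃ → u₃ ≤ rhoReq (2 + t₃)) (hu₃0 : t₃ = 0 → u₃ = 0 ∨ u₃ = 7 / 24)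
    (hfat : (rH = 7 / 24 → r₁ ≠ 7 / 24 ∧ r₂ ≠ 7 / 24 ∧ r₃ ≠ 7 / 24 ∧ u₁ ≠ 7 / 24 ∧ u₂ ≠ 7 / 24 ∧ u₃ ≠ 7 / 24) ∧
      (r₁ = 7 / 24 → r₂ ≠ 7 / 24 ∧ r₃ ≠ 7 / 24 ∧ u₁ ≠ 7 / 24 ∧ u₂ ≠ 7 / 24 ∧ u₃ ≠ 7 / 24) ∧
      (r₂ = 7 / 24 → r₃ ≠ 7 / 24 ∧ u₁ ≠ 7 / 24 ∧ u₂ ≠ 7 / 24 ∧ u₃ ≠ 7 / 24) ∧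
      (r₃ = 7 / 24 → u₁ ≠ 7 / 24 ∧ u₂ ≠ 7 / 24 ∧ u₃ ≠ 7 / 24) ∧
      (u₁ = 7 / 24 → u₂ ≠ 7 / 24 ∧ u₃ ≠ 7 / 24) ∧
      (u₂ = 7 / 24 → u₃ ≠ 7 / 24))
    (h3fat : r₃ = 7 / 24) :
    (4 ≤ e1o + e2o + eb + nZ → (max (rH + r₂ + r₃ - 11 / 18) 0 / (g₁ : ℚ) + max (rH + r₁ + r₃ - 11 / 18) 0 / (g₂ : ℚ) +
      max (rH + r₁ + r₂ - 11 / 18) 0 / (g₃ : ℚ)) +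
    (max (rH + u₂ + u₃ - 11 / 18) 0 / (h₁ : ℚ) + max (rH + u₁ + u₃ - 11 / 18) 0 / (h₂ : ℚ) +
      max (rH + u₁ + u₂ - 11 / 18) 0 / (h₃ : ℚ)) ≤ 11 / 18 - rH) ∧
    (max (rH + r₂ + r₃ - 11 / 18) 0 / (g₁ : ℚ) + max (rH + r₁ + r₃ - 11 / 18) 0 / (g₂ : ℚ) +
      max (rH + r₁ + r₂ - 11 / 18) 0 / (g₃ : ℚ)) +
    (max (rH + u₂ + u₃ - 11 / 18) 0 / (h₁ : ℚ) + max (rH + u₁ + u₃ - 11 / 18) 0 / (h₂ : ℚ) +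
      max (rH + u₁ + u₂ - 11 / 18) 0 / (h₃ : ℚ)) ≤ 23 / 45 := by
  have h := shapeOne_check_KF1 (e1o := e1o) (e2o := e2o) (eb := eb) (eb01 := eb01) (eb02 := eb02) (nZ := nZ) (mH := mH)
    (rH := rH) (fE₁ := fE₁) (a₁ := a₃) (a₂ := a₂) (a₃ := a₁) (zf₁ := zf₁) (z₁ := z₃) (z₂ := z₂) (z₃ := z₁)
    (s₁ := s₃) (s₂ := s₂) (s₃ := s₁) (g₁ := g₃) (g₂ := g₂) (g₃ := g₁) (r₁ := r₃) (r₂ := r₂) (r₃ := r₁)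
    hfE₁ (by omega) hfE₂ hbb hmH hnZ (by omega) (by omega) HZ2 (by omega) (by omega) (by omega) (by omega) (by omega) (by omega) ht₁ ht₂ ht₃ hh₁ hh₂ hh₃ hHnn hH2 hH3 hr₃nn hr₃adm hr₃0 hr₂nn hr₂adm hr₂0 hr₁nn hr₁adm hr₁0 hu₁nn hu₁adm hu₁0 hu₂nn hu₂adm hu₂0 hu₃nn hu₃adm hu₃0 (fatRule_perm13 hfat) h3fat
  have e₁ : max (rH + r₂ + r₁ - 11 / 18) 0 = max (rH + r₁ + r₂ - 11 / 18) 0 := by rw [add_right_comm]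
  have e₂ : max (rH + r₃ + r₁ - 11 / 18) 0 = max (rH + r₁ + r₃ - 11 / 18) 0 := by rw [add_right_comm]
  have e₃ : max (rH + r₃ + r₂ - 11 / 18) 0 = max (rH + r₂ + r₃ - 11 / 18) 0 := by rw [add_right_comm]
  rw [e₁, e₂, e₃] at h
  exact ⟨fun hOut => by linarith [h.1 hOut], by linarith [h.2]⟩

set_option maxHeartbeats 800000 in
/-- The finite check when some face of side `1` is fat. -/
theorem shapeOne_check_side1
    (hfE₁ : fE₁ = e1o + eb01) (hab : eb = eb01 + (a₁ + a₂ + a₃)) (hfE₂ : fE₂ = e2o + eb02)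
    (hbb : eb = eb02 + (b₁ + b₂ + b₃)) (hmH : mH = 1 + nZ) (hnZ : 1 ≤ nZ)
    (hζ : nZ ≤ zf₁ + (z₁ + z₂ + z₃) + (zf₂ + (y₁ + y₂ + y₃))) (HZ1 : zf₁ + (z₁ + z₂ + z₃) ≤ nZ)
    (HZ2 : zf₂ + (y₁ + y₂ + y₃) ≤ nZ)
    (hs₁ : s₁ = fE₁ + zf₁ + (a₂ + z₂) + (a₃ + z₃)) (hs₂ : s₂ = fE₁ + zf₁ + (a₁ + z₁) + (a₃ + z₃))
    (hs₃ : s₃ = fE₁ + zf₁ + (a₁ + z₁) + (a₂ + z₂))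
    (hg₁ : g₁ = 1 + fE₁ + a₁ + zf₁ + (z₁ + z₂ + z₃)) (hg₂ : g₂ = 1 + fE₁ + a₂ + zf₁ + (z₁ + z₂ + z₃))
    (hg₃ : g₃ = 1 + fE₁ + a₃ + zf₁ + (z₁ + z₂ + z₃))
    (ht₁ : t₁ = fE₂ + zf₂ + (b₂ + y₂) + (b₃ + y₃)) (ht₂ : t₂ = fE₂ + zf₂ + (b₁ + y₁) + (b₃ + y₃))
    (ht₃ : t₃ = fE₂ + zf₂ + (b₁ + y₁) + (b₂ + y₂))
    (hh₁ : h₁ = 1 + fE₂ + b₁ + zf₂ + (y₁ + y₂ + y₃)) (hh₂ : h₂ = 1 + fE₂ + b₂ + zf₂ + (y₁ + y₂ + y₃))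
    (hh₃ : h₃ = 1 + fE₂ + b₃ + zf₂ + (y₁ + y₂ + y₃))
    (hHnn : 0 ≤ rH) (hH2 : mH = 2 → rH = 0 ∨ rH = 7 / 24) (hH3 : 3 ≤ mH → rH ≤ rhoReq mH)
    (hr₁nn : 0 ≤ r₁) (hr₁adm : 1 ≤ s₁ → r₁ ≤ rhoReq (2 + s₁)) (hr₁0 : s₁ = 0 → r₁ = 0 ∨ r₁ = 7 / 24)
    (hr₂nn : 0 ≤ r₂) (hr₂adm : 1 ≤ s₂ → r₂ ≤ rhoReq (2 + s₂)) (hr₂0 : s₂ = 0 → r₂ = 0 ∨ r₂ = 7 / 24)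
    (hr₃nn : 0 ≤ r₃) (hr₃adm : 1 ≤ s₃ → r₃ ≤ rhoReq (2 + s₃)) (hr₃0 : s₃ = 0 → r₃ = 0 ∨ r₃ = 7 / 24)
    (hu₁nn : 0 ≤ u₁) (hu₁adm : 1 ≤ t₁ → u₁ ≤ rhoReq (2 + t₁)) (hu₁0 : t₁ = 0 → u₁ = 0 ∨ u₁ = 7 / 24)
    (hu₂nn : 0 ≤ u₂) (hu₂adm : 1 ≤ t₂ → u₂ ≤ rhoReq (2 + t₂)) (hu₂0 : t₂ = 0 → u₂ = 0 ∨ u₂ = 7 / 24)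
    (hu₃nn : 0 ≤ u₃) (hu₃adm : 1 ≤ t₃ → u₃ ≤ rhoReq (2 + t₃)) (hu₃0 : t₃ = 0 → u₃ = 0 ∨ u₃ = 7 / 24)
    (hfat : (rH = 7 / 24 → r₁ ≠ 7 / 24 ∧ r₂ ≠ 7 / 24 ∧ r₃ ≠ 7 / 24 ∧ u₁ ≠ 7 / 24 ∧ u₂ ≠ 7 / 24 ∧ u₃ ≠ 7 / 24) ∧
      (r₁ = 7 / 24 → r₂ ≠ 7 / 24 ∧ r₃ ≠ 7 / 24 ∧ u₁ ≠ 7 / 24 ∧ u₂ ≠ 7 / 24 ∧ u₃ ≠ 7 / 24) ∧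
      (r₂ = 7 / 24 → r₃ ≠ 7 / 24 ∧ u₁ ≠ 7 / 24 ∧ u₂ ≠ 7 / 24 ∧ u₃ ≠ 7 / 24) ∧
      (r₃ = 7 / 24 → u₁ ≠ 7 / 24 ∧ u₂ ≠ 7 / 24 ∧ u₃ ≠ 7 / 24) ∧
      (u₁ = 7 / 24 → u₂ ≠ 7 / 24 ∧ u₃ ≠ 7 / 24) ∧
      (u₂ = 7 / 24 → u₃ ≠ 7 / 24))
    (hsome : r₁ = 7 / 24 ∨ r₂ = 7 / 24 ∨ r₃ = 7 / 24) :
    (4 ≤ e1o + e2o + eb + nZ → (max (rH + r₂ + r₃ - 11 / 18) 0 / (g₁ : ℚ) + max (rH + r₁ + r₃ - 11 / 18) 0 / (g₂ : ℚ) +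
      max (rH + r₁ + r₂ - 11 / 18) 0 / (g₃ : ℚ)) +
    (max (rH + u₂ + u₃ - 11 / 18) 0 / (h₁ : ℚ) + max (rH + u₁ + u₃ - 11 / 18) 0 / (h₂ : ℚ) +
      max (rH + u₁ + u₂ - 11 / 18) 0 / (h₃ : ℚ)) ≤ 11 / 18 - rH) ∧
    (max (rH + r₂ + r₃ - 11 / 18) 0 / (g₁ : ℚ) + max (rH + r₁ + r₃ - 11 / 18) 0 / (g₂ : ℚ) +
      max (rH + r₁ + r₂ - 11 / 18) 0 / (g₃ : ℚ)) +
    (max (rH + u₂ + u₃ - 11 / 18) 0 / (h₁ : ℚ) + max (rH + u₁ + u₃ - 11 / 18) 0 / (h₂ : ℚ) +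
      max (rH + u₁ + u₂ - 11 / 18) 0 / (h₃ : ℚ)) ≤ 23 / 45 := by
  rcases hsome with h | h | h
  · exact shapeOne_check_KF1 hfE₁ hab hfE₂ hbb hmH hnZ hζ HZ1 HZ2 hs₁ hs₂ hs₃ hg₁ hg₂ hg₃ ht₁ ht₂ ht₃ hh₁ hh₂ hh₃ hHnn hH2 hH3 hr₁nn hr₁adm hr₁0 hr₂nn hr₂adm hr₂0 hr₃nn hr₃adm hr₃0 hu₁nn hu₁adm hu₁0 hu₂nn hu₂adm hu₂0 hu₃nn hu₃adm hu₃0 hfat h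
  · exact shapeOne_check_KF2 hfE₁ hab hfE₂ hbb hmH hnZ hζ HZ1 HZ2 hs₁ hs₂ hs₃ hg₁ hg₂ hg₃ ht₁ ht₂ ht₃ hh₁ hh₂ hh₃ hHnn hH2 hH3 hr₁nn hr₁adm hr₁0 hr₂nn hr₂adm hr₂0 hr₃nn hr₃adm hr₃0 hu₁nn hu₁adm hu₁0 hu₂nn hu₂adm hu₂0 hu₃nn hu₃adm hu₃0 hfat h
  · exact shapeOne_check_KF3 hfE₁ hab hfE₂ hbb hmH hnZ hζ HZ1 HZ2 hs₁ hs₂ hs₃ hg₁ hg₂ hg₃ ht₁ ht₂ ht₃ hh₁ hh₂ hh₃ hHnn hH2 hH3 hr₁nn hr₁adm hr₁0 hr₂nn hr₂adm hr₂0 hr₃nn hr₃adm hr₃0 hu₁nn hu₁adm hu₁0 hu₂nn hu₂adm hu₂0 hu₃nn hu₃adm hu₃0 hfat h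

set_option maxHeartbeats 1600000 in
/-- **THE FINITE CHECK OF THE SEVEN-POINT SHAPE (i)** (all regimes; proofs/NIGHT-2-g30.md §2, §4): (A) with the floor
`|E| + |Z| ≥ 4` the six losses split over the good points sum to at most `11/18 − r_H`; (B) they always sum to at most
`23/45`. -/
theorem shapeOne_finite_check
    (hfE₁ : fE₁ = e1o + eb01) (hab : eb = eb01 + (a₁ + a₂ + a₃)) (hfE₂ : fE₂ = e2o + eb02)
    (hbb : eb = eb02 + (b₁ + b₂ + b₃)) (hmH : mH = 1 + nZ) (hnZ : 1 ≤ nZ)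
    (hζ : nZ ≤ zf₁ + (z₁ + z₂ + z₃) + (zf₂ + (y₁ + y₂ + y₃))) (HZ1 : zf₁ + (z₁ + z₂ + z₃) ≤ nZ)
    (HZ2 : zf₂ + (y₁ + y₂ + y₃) ≤ nZ)
    (hs₁ : s₁ = fE₁ + zf₁ + (a₂ + z₂) + (a₃ + z₃)) (hs₂ : s₂ = fE₁ + zf₁ + (a₁ + z₁) + (a₃ + z₃))
    (hs₃ : s₃ = fE₁ + zf₁ + (a₁ + z₁) + (a₂ + z₂))
    (hg₁ : g₁ = 1 + fE₁ + a₁ + zf₁ + (z₁ + z₂ + z₃)) (hg₂ : g₂ = 1 + fE₁ + a₂ + zf₁ + (z₁ + z₂ + z₃))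
    (hg₃ : g₃ = 1 + fE₁ + a₃ + zf₁ + (z₁ + z₂ + z₃))
    (ht₁ : t₁ = fE₂ + zf₂ + (b₂ + y₂) + (b₃ + y₃)) (ht₂ : t₂ = fE₂ + zf₂ + (b₁ + y₁) + (b₃ + y₃))
    (ht₃ : t₃ = fE₂ + zf₂ + (b₁ + y₁) + (b₂ + y₂))
    (hh₁ : h₁ = 1 + fE₂ + b₁ + zf₂ + (y₁ + y₂ + y₃)) (hh₂ : h₂ = 1 + fE₂ + b₂ + zf₂ + (y₁ + y₂ + y₃))
    (hh₃ : h₃ = 1 + fE₂ + b₃ + zf₂ + (y₁ + y₂ + y₃))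
    (hHnn : 0 ≤ rH) (hH2 : mH = 2 → rH = 0 ∨ rH = 7 / 24) (hH3 : 3 ≤ mH → rH ≤ rhoReq mH)
    (hr₁nn : 0 ≤ r₁) (hr₁adm : 1 ≤ s₁ → r₁ ≤ rhoReq (2 + s₁)) (hr₁0 : s₁ = 0 → r₁ = 0 ∨ r₁ = 7 / 24)
    (hr₂nn : 0 ≤ r₂) (hr₂adm : 1 ≤ s₂ → r₂ ≤ rhoReq (2 + s₂)) (hr₂0 : s₂ = 0 → r₂ = 0 ∨ r₂ = 7 / 24)
    (hr₃nn : 0 ≤ r₃) (hr₃adm : 1 ≤ s₃ → r₃ ≤ rhoReq (2 + s₃)) (hr₃0 : s₃ = 0 → r₃ = 0 ∨ r₃ = 7 / 24)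
    (hu₁nn : 0 ≤ u₁) (hu₁adm : 1 ≤ t₁ → u₁ ≤ rhoReq (2 + t₁)) (hu₁0 : t₁ = 0 → u₁ = 0 ∨ u₁ = 7 / 24)
    (hu₂nn : 0 ≤ u₂) (hu₂adm : 1 ≤ t₂ → u₂ ≤ rhoReq (2 + t₂)) (hu₂0 : t₂ = 0 → u₂ = 0 ∨ u₂ = 7 / 24)
    (hu₃nn : 0 ≤ u₃) (hu₃adm : 1 ≤ t₃ → u₃ ≤ rhoReq (2 + t₃)) (hu₃0 : t₃ = 0 → u₃ = 0 ∨ u₃ = 7 / 24)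
    (hfat : (rH = 7 / 24 → r₁ ≠ 7 / 24 ∧ r₂ ≠ 7 / 24 ∧ r₃ ≠ 7 / 24 ∧ u₁ ≠ 7 / 24 ∧ u₂ ≠ 7 / 24 ∧ u₃ ≠ 7 / 24) ∧
      (r₁ = 7 / 24 → r₂ ≠ 7 / 24 ∧ r₃ ≠ 7 / 24 ∧ u₁ ≠ 7 / 24 ∧ u₂ ≠ 7 / 24 ∧ u₃ ≠ 7 / 24) ∧
      (r₂ = 7 / 24 → r₃ ≠ 7 / 24 ∧ u₁ ≠ 7 / 24 ∧ u₂ ≠ 7 / 24 ∧ u₃ ≠ 7 / 24) ∧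
      (r₃ = 7 / 24 → u₁ ≠ 7 / 24 ∧ u₂ ≠ 7 / 24 ∧ u₃ ≠ 7 / 24) ∧
      (u₁ = 7 / 24 → u₂ ≠ 7 / 24 ∧ u₃ ≠ 7 / 24) ∧
      (u₂ = 7 / 24 → u₃ ≠ 7 / 24)) :
    (4 ≤ e1o + e2o + eb + nZ → (max (rH + r₂ + r₃ - 11 / 18) 0 / (g₁ : ℚ) + max (rH + r₁ + r₃ - 11 / 18) 0 / (g₂ : ℚ) +
      max (rH + r₁ + r₂ - 11 / 18) 0 / (g₃ : ℚ)) +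
    (max (rH + u₂ + u₃ - 11 / 18) 0 / (h₁ : ℚ) + max (rH + u₁ + u₃ - 11 / 18) 0 / (h₂ : ℚ) +
      max (rH + u₁ + u₂ - 11 / 18) 0 / (h₃ : ℚ)) ≤ 11 / 18 - rH) ∧
    (max (rH + r₂ + r₃ - 11 / 18) 0 / (g₁ : ℚ) + max (rH + r₁ + r₃ - 11 / 18) 0 / (g₂ : ℚ) +
      max (rH + r₁ + r₂ - 11 / 18) 0 / (g₃ : ℚ)) +
    (max (rH + u₂ + u₃ - 11 / 18) 0 / (h₁ : ℚ) + max (rH + u₁ + u₃ - 11 / 18) 0 / (h₂ : ℚ) +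
      max (rH + u₁ + u₂ - 11 / 18) 0 / (h₃ : ℚ)) ≤ 23 / 45 := by
  by_cases hHfat : rH = 7 / 24
  · -- THE H-FAT REGIME
    obtain ⟨n1, n2, n3, m1, m2, m3⟩ := hfat.1 hHfat
    have hnZ1 := nZ_eq_one_of_rH_fat hH3 hmH hnZ hHfat
    obtain ⟨hr₁, h₁0⟩ := nonfat_of_adm hr₁nn hr₁adm hr₁0 n1
    obtain ⟨hr₂, h₂0⟩ := nonfat_of_adm hr₂nn hr₂adm hr₂0 n2
    obtain ⟨hr₃, h₃0⟩ := nonfat_of_adm hr₃nn hr₃adm hr₃0 n3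
    obtain ⟨hu₁, hu₁0⟩ := nonfat_of_adm hu₁nn hu₁adm hu₁0 m1
    obtain ⟨hu₂, hu₂0⟩ := nonfat_of_adm hu₂nn hu₂adm hu₂0 m2
    obtain ⟨hu₃, hu₃0⟩ := nonfat_of_adm hu₃nn hu₃adm hu₃0 m3
    subst hHfat
    constructor
    · intro hOut
      have h := shapeOne_couplingHF (by omega) hfE₁ hab hfE₂ hbb (by omega) (by omega) (by omega) hs₁ hs₂ hs₃ hg₁ hg₂ hg₃
        hr₁ h₁0 hr₂ h₂0 hr₃ h₃0 ht₁ ht₂ ht₃ hh₁ hh₂ hh₃ hu₁ hu₁0 hu₂ hu₂0 hu₃ hu₃0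
      have : (11 : ℚ) / 18 - 7 / 24 = 23 / 72 := by norm_num
      linarith
    · have P1₁ := sideHF_le_P1 hs₁ hs₂ hs₃ hg₁ hg₂ hg₃ hr₁ h₁0 hr₂ h₂0 hr₃ h₃0
      have P1₂ := sideHF_le_P1 ht₁ ht₂ ht₃ hh₁ hh₂ hh₃ hu₁ hu₁0 hu₂ hu₂0 hu₃ hu₃0
      linarith
  · by_cases hs1 : r₁ = 7 / 24 ∨ r₂ = 7 / 24 ∨ r₃ = 7 / 24
    · exact shapeOne_check_side1 hfE₁ hab hfE₂ hbb hmH hnZ hζ HZ1 HZ2 hs₁ hs₂ hs₃ hg₁ hg₂ hg₃ ht₁ ht₂ ht₃ hh₁ hh₂ hh₃ hHnn hH2 hH3 hr₁nn hr₁adm hr₁0 hr₂nn hr₂adm hr₂0 hr₃nn hr₃adm hr₃0 hu₁nn hu₁adm hu₁0 hu₂nn hu₂adm hu₂0 hu₃nn hu₃adm hu₃0 hfat hs1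
    · by_cases hs2 : u₁ = 7 / 24 ∨ u₂ = 7 / 24 ∨ u₃ = 7 / 24
      · -- the fat face is on side `2`: swap the sides
        have h := shapeOne_check_side1 (e1o := e2o) (e2o := e1o) (eb := eb) (eb01 := eb02) (eb02 := eb01) (nZ := nZ)
          (mH := mH) (rH := rH) (fE₁ := fE₂) (a₁ := b₁) (a₂ := b₂) (a₃ := b₃) (zf₁ := zf₂) (z₁ := y₁) (z₂ := y₂) (z₃ := y₃)
          (s₁ := t₁) (s₂ := t₂) (s₃ := t₃) (g₁ := h₁) (g₂ := h₂) (g₃ := h₃) (r₁ := u₁) (r₂ := u₂) (r₃ := u₃)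
          (fE₂ := fE₁) (b₁ := a₁) (b₂ := a₂) (b₃ := a₃) (zf₂ := zf₁) (y₁ := z₁) (y₂ := z₂) (y₃ := z₃)
          (t₁ := s₁) (t₂ := s₂) (t₃ := s₃) (h₁ := g₁) (h₂ := g₂) (h₃ := g₃) (u₁ := r₁) (u₂ := r₂) (u₃ := r₃)
          hfE₂ hbb hfE₁ hab hmH hnZ (by omega) HZ2 HZ1 ht₁ ht₂ ht₃ hh₁ hh₂ hh₃ hs₁ hs₂ hs₃ hg₁ hg₂ hg₃ hHnn hH2 hH3 hu₁nn hu₁adm hu₁0 hu₂nn hu₂adm hu₂0 hu₃nn hu₃adm hu₃0 hr₁nn hr₁adm hr₁0 hr₂nn hr₂adm hr₂0 hr₃nn hr₃adm hr₃0 (fatRule_swap hfat) hs2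
        exact ⟨fun hOut => by linarith [h.1 (by omega)], by linarith [h.2]⟩
      · -- THE NO-FAT REGIME
        push Not at hs1 hs2
        obtain ⟨hH, -, -⟩ := rH_facts hHnn hH2 hH3 hmH hnZ hHfat
        obtain ⟨hr₁, h₁0⟩ := nonfat_of_adm hr₁nn hr₁adm hr₁0 hs1.1
        obtain ⟨hr₂, h₂0⟩ := nonfat_of_adm hr₂nn hr₂adm hr₂0 hs1.2.1
        obtain ⟨hr₃, h₃0⟩ := nonfat_of_adm hr₃nn hr₃adm hr₃0 hs1.2.2
        obtain ⟨hu₁, hu₁0⟩ := nonfat_of_adm hu₁nn hu₁adm hu₁0 hs2.1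
        obtain ⟨hu₂, hu₂0⟩ := nonfat_of_adm hu₂nn hu₂adm hu₂0 hs2.2.1
        obtain ⟨hu₃, hu₃0⟩ := nonfat_of_adm hu₃nn hu₃adm hu₃0 hs2.2.2
        have h := shapeOne_couplingNF hH hs₁ hs₂ hs₃ hg₁ hg₂ hg₃ hr₁ h₁0 hr₂ h₂0 hr₃ h₃0 ht₁ ht₂ ht₃ hh₁ hh₂ hh₃
          hu₁ hu₁0 hu₂ hu₂0 hu₃ hu₃0
        exact ⟨fun _ => by linarith, by linarith⟩

end Check

end PercRepro.Shadow
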